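import Summits.QuantumFields.BalabanUV.Beta.GAN24.ExponentialChartHessianKernels

/-!
# `BalabanUV.Beta.GAN24.ExponentialChartHessianMoments` — binder row G-an2-4 ∕ (CONV-C), route R7 «TWO CURRENCIES», PART 259: THE β-TYPE NUMBERS OF THE ONE-LOOP HESSIAN —
# `b_k(A, B) := Σ_x Π_k(A, B)_{μν}(x) x_μ x_ν` ((1.22)'s second moment of the level-`k` infinite-volume limit kernel of PART 254's Hessian family) AND `b_∞(A, B)` (the second moment
# of the telescoped limit kernel `limKernelOf Π(A, B)`) — ARE SYMMETRIC BILINEAR FUNCTIONS OF THE BACKGROUND FAMILIES, AND THE DIAGONAL IS PART 247's `N = 2` NUMBER.  PART 258 gave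
# the identities at the level of KERNELS (pointwise on `ℤ^d`); this file passes them through the two linear functionals of the β-cell's `LimitRate` currency: `secondMoment` (a
# `tsum` — additivity needs the absolute convergence supplied by (UD) `UniformDecay` with `δ > 0`; symmetry ∕ homogeneity ∕ the diagonal need NOTHING) and `limKernelOf` (the
# telescoped limit — additivity needs the (PR′) `StepRate` summability; homogeneity ∕ congruence need nothing), and the limit numbers `b_∞` through the END's rate
# `|secondMoment (Π k) − secondMoment (limKernelOf Π)| ≤ c·θ^k` (`tendsto_of_abs_sub_le_geometric` + `tendsto_nhds_unique`).  §1 is GENERIC kernel-family algebra (any `d`, any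
# kernels); §2 the Hessian instance over PART 258 (the hypothesis-free corollary over PART 254's END, displaying only `(α, β)` and EL₁, is PART 260
# `ExponentialChartHessianMomentsEnd`) (unit b2b-balaban-gan24-p3, gen 67; v1; generator `HOME/b2b-balaban-gan24-p3/gen67/records/gen/gen259.py`)

NOT IN PRINT; OUR PROOF ([folklore] bookkeeping BY NAME over PART 258 (`hessianKernel_symm ∕ _diag ∕ _add_left ∕ _smul_left ∕ _add_right ∕ _smul_right`), the β-cell's
`LimitRate` (`UniformDecay.summable`, `StepRate.summable`,
`tendsto_of_abs_sub_le_geometric`), Mathlib's `Summable.tsum_add`, `tsum_mul_left`, `Summable.tendsto_sum_tsum_nat`, `Finset.sum_range_sub`, `tendsto_nhds_unique`;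
[Balaban1987RG1] (1.20)–(1.22) p. 264 LOCATE the shapes (β as the second moment of the vacuum-polarisation kernel); nothing printed is a hypothesis).
HONEST FRAMING (cell contract, verbatim): «discharging `BetaPertH` makes Bałaban's UV stability UNCONDITIONAL — a real constructive-QFT result; it is NOT the
continuum limit and NOT the Clay problem.»  HONEST DEPENDENCY (verbatim): «continuum YM on T⁴ ⇐ BetaPertH ∧ nine spine estimates (0/9 proved); BetaPertH ⇐
(D1) ∧ (D4) ∧ CAP+tail; G-an2-4 gates asym, D1 and NE2/3/4.»

WHAT THIS FILE PROVES (0 sorry, 0 `def`):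
* §1 (GENERIC, any kernel families `P, Q, R : ℕ → B12Beta.Kernel d`, a pair `(μ, ν)`): `secondMoment_congr`, **`secondMoment_add_of_summable`**, **`secondMoment_const_mul`**,
  `limKernelOf_apply`, `limKernelOf_congr_apply`, **`limKernelOf_const_mul_apply`**, **`tendsto_limKernelOf_of_summable`**, **`limKernelOf_add_apply`** (+ `_of_stepRate`),
  **`secondMoment_limKernelOf_add_of_rate`**, `secondMoment_limKernelOf_const_mul`, `secondMoment_limKernelOf_congr`.
* §2 (the Hessian families of PART 254 ∕ 258, even cubic volumes `2(t+1)`, ANY `IsInfiniteVolumeLimit` kernels at every level): **`hessianMoments_symm`**, **`hessianMoments_diag`**,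
  **`hessianMoments_smul_left`**, `hessianMoments_smul_right` (NO analytic hypothesis: every level, the telescoped limit kernel, and its second moment);
  **`hessianMoments_add_left`**, `hessianMoments_add_right` (every level under (UD) with `δ > 0` for the two summands; the limit numbers under the END's rates, `0 ≤ θ < 1`);
  `limKernelOf_hessianKernel_add_left` (the telescoped limit kernels add under (PR′) `StepRate`).
WHAT IT DOES NOT DO: existence of the kernels (PART 254; the corollary displaying only `(α, β)` and EL₁ is PART 260); base points `U₀ ≠ 1`; colour; Bałaban's `−∂P∂*` ∕ `aQ(U)*Q(U)`
parts; the identification of `Π_k(A, A)` with row an1's `Π⁰_{k+1}` (OWNER ∕ an1).  SUPPLIER work; NEVER «G-an2-4 closed»; NOT (CONV-C), NOT D1, NOT `BetaPertH`, NOT continuum, NOT Clay.  Records: `HOME/b2b-balaban-gan24-p3/gen67/README.md`.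
-/

noncomputable section

open scoped BigOperators ComplexConjugate Matrix Matrix.Norms.L2Operator
open Filter Topology

namespace Summit.QuantumFields.BalabanUV.Beta.GAN24.ExponentialChartHessianMoments

open Literature.MathematicalPhysics.QuantumFieldTheory.Balaban1983to89
open Literature.MathematicalPhysics.QuantumFieldTheory.Balaban1983to89.B5Prop11Plancherel (Tor fine)
open Literature.MathematicalPhysics.QuantumFieldTheory.Balaban1983to89.B5G183RateUnitTower (lev)
open Literature.MathematicalPhysics.QuantumFieldTheory.Balaban1983to89.Beta (Site IsInfiniteVolumeLimit)
open Literature.MathematicalPhysics.QuantumFieldTheory.Balaban1983to89.Beta.FreeLegDictionary (cubic)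
open Literature.MathematicalPhysics.QuantumFieldTheory.Balaban1983to89.Beta.BlockKernelVolumeSockets (evenPeriod)
open Literature.MathematicalPhysics.QuantumFieldTheory.Balaban1983to89.Beta.LimitRate (UniformDecay StepRate limKernelOf tendsto_of_abs_sub_le_geometric)
open Summit.QuantumFields.BalabanUV.T4Continuum
open Summit.QuantumFields.BalabanUV.T4Continuum.CovariantAveragingTower (avgTow)
open Summit.QuantumFields.BalabanUV.T4Continuum.BalabanAveragedTowerUnit (idx QBlev)
open Summit.QuantumFields.BalabanUV.T4Continuum.BalabanAveragedCoerciveTower (unitIdx)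
open Summit.QuantumFields.BalabanUV.T4Continuum.KingPairingPlantedLaw (calDalev)
open Summit.QuantumFields.BalabanUV.T4Continuum.AbelianCovariantLaplacian (covPert)
open Summit.QuantumFields.BalabanUV.Beta.GAN24.ExponentialChartHessianKernels (hessianKernel_symm hessianKernel_diag hessianKernel_add_left hessianKernel_smul_left
  hessianKernel_add_right hessianKernel_smul_right)

/-! ## §1 GENERIC: the second moment and the telescoped limit kernel are linear in the kernel family -/

section Generic

variable {d : ℕ}

/-- kernels agreeing pointwise in the `(μ, ν)` component have the same second moment (1.22). [folklore] -/
theorem secondMoment_congr {P Q : B12Beta.Kernel d} {μ ν : Fin d} (h : ∀ x, P μ ν x = Q μ ν x) :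
    B12Beta.secondMoment P μ ν = B12Beta.secondMoment Q μ ν := by
  unfold B12Beta.secondMoment
  exact tsum_congr fun x => by rw [h x]

/-- **`secondMoment_add_of_summable`** — (1.22) is ADDITIVE in the kernel when both second moments converge absolutely (`Summable.tsum_add`). [folklore] -/
theorem secondMoment_add_of_summable {P Q R : B12Beta.Kernel d} {μ ν : Fin d} (h : ∀ x, R μ ν x = P μ ν x + Q μ ν x)
    (hP : Summable fun x : Fin d → ℤ => P μ ν x * (x μ : ℝ) * (x ν : ℝ)) (hQ : Summable fun x : Fin d → ℤ => Q μ ν x * (x μ : ℝ) * (x ν : ℝ)) :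
    B12Beta.secondMoment R μ ν = B12Beta.secondMoment P μ ν + B12Beta.secondMoment Q μ ν := by
  unfold B12Beta.secondMoment
  rw [← hP.tsum_add hQ]
  exact tsum_congr fun x => by rw [h x]; ring

/-- **`secondMoment_const_mul`** — (1.22) is HOMOGENEOUS in the kernel (`tsum_mul_left`; no summability needed). [folklore] -/
theorem secondMoment_const_mul (c : ℝ) {P R : B12Beta.Kernel d} {μ ν : Fin d} (h : ∀ x, R μ ν x = c * P μ ν x) :
    B12Beta.secondMoment R μ ν = c * B12Beta.secondMoment P μ ν := by
  unfold B12Beta.secondMoment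
  rw [← tsum_mul_left]
  exact tsum_congr fun x => by rw [h x]; ring

/-- the telescoped limit kernel, unfolded. [folklore] -/
theorem limKernelOf_apply (P : ℕ → B12Beta.Kernel d) (μ ν : Fin d) (x : Fin d → ℤ) :
    limKernelOf P μ ν x = P 0 μ ν x + ∑' j, (P (j + 1) μ ν x - P j μ ν x) := rfl

/-- families agreeing at every level in the `(μ, ν)` component at `x` have the same telescoped limit there. [folklore] -/
theorem limKernelOf_congr_apply {P Q : ℕ → B12Beta.Kernel d} {μ ν : Fin d} {x : Fin d → ℤ} (h : ∀ k, P k μ ν x = Q k μ ν x) :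
    limKernelOf P μ ν x = limKernelOf Q μ ν x := by
  simp only [limKernelOf_apply, h]

/-- **`limKernelOf_const_mul_apply`** — the telescoped limit kernel is HOMOGENEOUS in the family (`tsum_mul_left`; no summability needed). [folklore] -/
theorem limKernelOf_const_mul_apply (c : ℝ) {P R : ℕ → B12Beta.Kernel d} {μ ν : Fin d} {x : Fin d → ℤ} (h : ∀ k, R k μ ν x = c * P k μ ν x) :
    limKernelOf R μ ν x = c * limKernelOf P μ ν x := by
  simp only [limKernelOf_apply, h, ← mul_sub, tsum_mul_left, mul_add]

/-- **`tendsto_limKernelOf_of_summable`** — if the telescoping series at `x` converges, the levels converge to the telescoped limit kernel at `x` (partial sums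
`Σ_{j<k}(P_{j+1} − P_j) = P_k − P_0`). [folklore] -/
theorem tendsto_limKernelOf_of_summable {P : ℕ → B12Beta.Kernel d} {μ ν : Fin d} {x : Fin d → ℤ} (hs : Summable fun j => P (j + 1) μ ν x - P j μ ν x) :
    Tendsto (fun k => P k μ ν x) atTop (𝓝 (limKernelOf P μ ν x)) := by
  have htel : ∀ k, ∑ j ∈ Finset.range k, (P (j + 1) μ ν x - P j μ ν x) = P k μ ν x - P 0 μ ν x := fun k =>
    Finset.sum_range_sub (fun j => P j μ ν x) k
  refine ((hs.tendsto_sum_tsum_nat).const_add (P 0 μ ν x)).congr fun k => ?_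
  rw [htel k]
  ring

/-- **`limKernelOf_add_apply`** — the telescoped limit kernel is ADDITIVE in the family at every site where the two telescoping series converge. [folklore] -/
theorem limKernelOf_add_apply {P Q R : ℕ → B12Beta.Kernel d} {μ ν : Fin d} {x : Fin d → ℤ} (hP : Summable fun j => P (j + 1) μ ν x - P j μ ν x)
    (hQ : Summable fun j => Q (j + 1) μ ν x - Q j μ ν x) (h : ∀ k, R k μ ν x = P k μ ν x + Q k μ ν x) :
    limKernelOf R μ ν x = limKernelOf P μ ν x + limKernelOf Q μ ν x := by
  have e : ∀ j, P (j + 1) μ ν x + Q (j + 1) μ ν x - (P j μ ν x + Q j μ ν x) = (P (j + 1) μ ν x - P j μ ν x) + (Q (j + 1) μ ν x - Q j μ ν x) := fun j => by ring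
  simp only [limKernelOf_apply, h, e]
  rw [hP.tsum_add hQ]
  ring

/-- `limKernelOf_add_apply` under (PR′) `StepRate` for the two summands (`0 ≤ θ < 1`; `StepRate.summable`). [folklore] -/
theorem limKernelOf_add_apply_of_stepRate {P Q R : ℕ → B12Beta.Kernel d} {μ ν : Fin d} {C₁ δ₁ C₂ δ₂ θ : ℝ} (hθ0 : 0 ≤ θ) (hθ1 : θ < 1) (hP : StepRate P μ ν C₁ δ₁ θ)
    (hQ : StepRate Q μ ν C₂ δ₂ θ) (h : ∀ k x, R k μ ν x = P k μ ν x + Q k μ ν x) (x : Fin d → ℤ) :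
    limKernelOf R μ ν x = limKernelOf P μ ν x + limKernelOf Q μ ν x :=
  limKernelOf_add_apply (hP.summable hθ0 hθ1 x) (hQ.summable hθ0 hθ1 x) fun k => h k x

/-- **`secondMoment_limKernelOf_add_of_rate`** — THE LIMIT NUMBERS ADD: if the three families have the END's rate `|Σ_xΠ_k x_μx_ν − Σ_xΠ_∞ x_μx_ν| ≤ c·θ^k` (`0 ≤ θ < 1`) and the
level numbers add, then the limit numbers add (`tendsto_of_abs_sub_le_geometric`, `tendsto_nhds_unique`). [folklore] -/
theorem secondMoment_limKernelOf_add_of_rate {P Q R : ℕ → B12Beta.Kernel d} {μ ν : Fin d} {cP cQ cR θ : ℝ} (hθ0 : 0 ≤ θ) (hθ1 : θ < 1)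
    (hP : ∀ k, |B12Beta.secondMoment (P k) μ ν - B12Beta.secondMoment (limKernelOf P) μ ν| ≤ cP * θ ^ k)
    (hQ : ∀ k, |B12Beta.secondMoment (Q k) μ ν - B12Beta.secondMoment (limKernelOf Q) μ ν| ≤ cQ * θ ^ k)
    (hR : ∀ k, |B12Beta.secondMoment (R k) μ ν - B12Beta.secondMoment (limKernelOf R) μ ν| ≤ cR * θ ^ k)
    (h : ∀ k, B12Beta.secondMoment (R k) μ ν = B12Beta.secondMoment (P k) μ ν + B12Beta.secondMoment (Q k) μ ν) :
    B12Beta.secondMoment (limKernelOf R) μ ν = B12Beta.secondMoment (limKernelOf P) μ ν + B12Beta.secondMoment (limKernelOf Q) μ ν :=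
  tendsto_nhds_unique (tendsto_of_abs_sub_le_geometric hθ0 hθ1 hR)
    (((tendsto_of_abs_sub_le_geometric hθ0 hθ1 hP).add (tendsto_of_abs_sub_le_geometric hθ0 hθ1 hQ)).congr fun k => (h k).symm)

/-- the limit number is homogeneous in the family (no hypothesis: `limKernelOf_const_mul_apply` + `secondMoment_const_mul`). [folklore] -/
theorem secondMoment_limKernelOf_const_mul (c : ℝ) {P R : ℕ → B12Beta.Kernel d} {μ ν : Fin d} (h : ∀ k x, R k μ ν x = c * P k μ ν x) :
    B12Beta.secondMoment (limKernelOf R) μ ν = c * B12Beta.secondMoment (limKernelOf P) μ ν :=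
  secondMoment_const_mul c fun x => limKernelOf_const_mul_apply c fun k => h k x

/-- families agreeing at every level in the `(μ, ν)` component have the same limit number (no hypothesis). [folklore] -/
theorem secondMoment_limKernelOf_congr {P Q : ℕ → B12Beta.Kernel d} {μ ν : Fin d} (h : ∀ k x, P k μ ν x = Q k μ ν x) :
    B12Beta.secondMoment (limKernelOf P) μ ν = B12Beta.secondMoment (limKernelOf Q) μ ν :=
  secondMoment_congr fun x => limKernelOf_congr_apply fun k => h k x

end Generic

/-! ## §2 THE HESSIAN INSTANCE: the β-type numbers of the one-loop Hessian are a symmetric bilinear function of the backgrounds -/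

section Hessian

variable {d : ℕ} (L : ℕ) [NeZero L] (a : ℝ) (ha : 0 < a)

/-- **`hessianMoments_symm` — THE β-TYPE NUMBERS OF THE HESSIAN ARE SYMMETRIC IN THE BACKGROUNDS**: for ANY infinite-volume limit kernels `Π` of the Hessian family of
`(A, B)` and `Π′` of `(B, A)` (every level): every level number, the telescoped limit kernels, and the limit numbers agree — NO analytic hypothesis (PART 258's
`hessianKernel_symm` + §1's congruences). [our proof] -/
theorem hessianMoments_symm {A B : (t : ℕ) → (k : ℕ) → Fin d → (idx L (cubic d (evenPeriod t)) k → ℝ)} {P P' : ℕ → B12Beta.Kernel d}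
    (h : ∀ k, IsInfiniteVolumeLimit evenPeriod
      (fun t μ' ν' (z : Site d (evenPeriod t)) =>
          ((deriv (fun r : ℝ => deriv (fun s : ℝ => (avgTow (QBlev L (cubic d (evenPeriod t))) ((L : ℝ) ^ d)
          (fun k' => (calDalev L (cubic d (evenPeriod t)) a ha k' + covPert L (cubic d (evenPeriod t)) (fun k'' ν' (x' : idx L (cubic d (evenPeriod t)) k'') => Complex.exp
                ((Complex.I * ((A t k'' ν' x' : ℝ) : ℂ) / ((lev L k'' : ℕ) : ℂ)) * ((s : ℝ) : ℂ) + (Complex.I * ((B t k'' ν' x' : ℝ) : ℂ) / ((lev L k'' : ℕ) : ℂ)) * ((r : ℝ) :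
                ℂ))) k')⁻¹) k)⁻¹) 0) 0)
            ((unitIdx L (cubic d (evenPeriod t))).symm (z, μ')) ((unitIdx L (cubic d (evenPeriod t))).symm (0, ν'))).re) (P k))
    (h' : ∀ k, IsInfiniteVolumeLimit evenPeriod
      (fun t μ' ν' (z : Site d (evenPeriod t)) =>
          ((deriv (fun r : ℝ => deriv (fun s : ℝ => (avgTow (QBlev L (cubic d (evenPeriod t))) ((L : ℝ) ^ d)
          (fun k' => (calDalev L (cubic d (evenPeriod t)) a ha k' + covPert L (cubic d (evenPeriod t)) (fun k'' ν' (x' : idx L (cubic d (evenPeriod t)) k'') => Complex.exp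
                ((Complex.I * ((B t k'' ν' x' : ℝ) : ℂ) / ((lev L k'' : ℕ) : ℂ)) * ((s : ℝ) : ℂ) + (Complex.I * ((A t k'' ν' x' : ℝ) : ℂ) / ((lev L k'' : ℕ) : ℂ)) * ((r : ℝ) :
                ℂ))) k')⁻¹) k)⁻¹) 0) 0)
            ((unitIdx L (cubic d (evenPeriod t))).symm (z, μ')) ((unitIdx L (cubic d (evenPeriod t))).symm (0, ν'))).re) (P' k)) :
    (∀ k μ ν, B12Beta.secondMoment (P k) μ ν = B12Beta.secondMoment (P' k) μ ν) ∧ (∀ μ ν x, limKernelOf P μ ν x = limKernelOf P' μ ν x) ∧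
      ∀ μ ν, B12Beta.secondMoment (limKernelOf P) μ ν = B12Beta.secondMoment (limKernelOf P') μ ν := by
  have e : ∀ k μ ν x, P k μ ν x = P' k μ ν x := fun k => hessianKernel_symm L a ha k (h k) (h' k)
  exact ⟨fun k μ ν => secondMoment_congr (e k μ ν), fun μ ν x => limKernelOf_congr_apply fun k => e k μ ν x, fun μ ν => secondMoment_limKernelOf_congr fun k => e k μ ν⟩

/-- **`hessianMoments_diag` — THE DIAGONAL NUMBERS ARE PART 247's `N = 2` NUMBERS**: for ANY limit kernels `Π` of the Hessian family of `(A, A)` and `Π⁽²⁾` of PART 247's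
`∂²_s|₀` family of `A` (every level): level numbers, telescoped limit kernels and limit numbers agree — NO analytic hypothesis (PART 258's `hessianKernel_diag`). [our proof] -/
theorem hessianMoments_diag {A : (t : ℕ) → (k : ℕ) → Fin d → (idx L (cubic d (evenPeriod t)) k → ℝ)} {P P2 : ℕ → B12Beta.Kernel d}
    (h : ∀ k, IsInfiniteVolumeLimit evenPeriod
      (fun t μ' ν' (z : Site d (evenPeriod t)) =>
          ((deriv (fun r : ℝ => deriv (fun s : ℝ => (avgTow (QBlev L (cubic d (evenPeriod t))) ((L : ℝ) ^ d)
          (fun k' => (calDalev L (cubic d (evenPeriod t)) a ha k' + covPert L (cubic d (evenPeriod t)) (fun k'' ν' (x' : idx L (cubic d (evenPeriod t)) k'') => Complex.exp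
                ((Complex.I * ((A t k'' ν' x' : ℝ) : ℂ) / ((lev L k'' : ℕ) : ℂ)) * ((s : ℝ) : ℂ) + (Complex.I * ((A t k'' ν' x' : ℝ) : ℂ) / ((lev L k'' : ℕ) : ℂ)) * ((r : ℝ) :
                ℂ))) k')⁻¹) k)⁻¹) 0) 0)
            ((unitIdx L (cubic d (evenPeriod t))).symm (z, μ')) ((unitIdx L (cubic d (evenPeriod t))).symm (0, ν'))).re) (P k))
    (h2 : ∀ k, IsInfiniteVolumeLimit evenPeriod
      (fun t μ' ν' (z : Site d (evenPeriod t)) =>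
          ((iteratedDeriv 2 (fun s : ℝ => (avgTow (QBlev L (cubic d (evenPeriod t))) ((L : ℝ) ^ d)
          (fun k' => (calDalev L (cubic d (evenPeriod t)) a ha k' + covPert L (cubic d (evenPeriod t)) (fun k'' ν' (x' : idx L (cubic d (evenPeriod t)) k'') => Complex.exp
                ((Complex.I * ((A t k'' ν' x' : ℝ) : ℂ) / ((lev L k'' : ℕ) : ℂ)) * ((s : ℝ) : ℂ))) k')⁻¹) k)⁻¹) 0)
            ((unitIdx L (cubic d (evenPeriod t))).symm (z, μ')) ((unitIdx L (cubic d (evenPeriod t))).symm (0, ν'))).re) (P2 k)) :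
    (∀ k μ ν, B12Beta.secondMoment (P k) μ ν = B12Beta.secondMoment (P2 k) μ ν) ∧ (∀ μ ν x, limKernelOf P μ ν x = limKernelOf P2 μ ν x) ∧
      ∀ μ ν, B12Beta.secondMoment (limKernelOf P) μ ν = B12Beta.secondMoment (limKernelOf P2) μ ν := by
  have e : ∀ k μ ν x, P k μ ν x = P2 k μ ν x := fun k => hessianKernel_diag L a ha k (h k) (h2 k)
  exact ⟨fun k μ ν => secondMoment_congr (e k μ ν), fun μ ν x => limKernelOf_congr_apply fun k => e k μ ν x, fun μ ν => secondMoment_limKernelOf_congr fun k => e k μ ν⟩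

/-- **`hessianMoments_smul_left` — HOMOGENEITY IN THE FIRST BACKGROUND** (real `c`): for ANY limit kernels `Π` of `(A, B)` and `Π_c` of `(cA, B)`: `b_k(cA, B) = c·b_k(A, B)`
at every level, `limKernelOf Π_c = c·limKernelOf Π` pointwise, `b_∞(cA, B) = c·b_∞(A, B)` — NO analytic hypothesis (PART 258's `hessianKernel_smul_left`; `tsum_mul_left`).
[our proof] -/
theorem hessianMoments_smul_left (c : ℝ) {A B : (t : ℕ) → (k : ℕ) → Fin d → (idx L (cubic d (evenPeriod t)) k → ℝ)} {P Pc : ℕ → B12Beta.Kernel d}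
    (h : ∀ k, IsInfiniteVolumeLimit evenPeriod
      (fun t μ' ν' (z : Site d (evenPeriod t)) =>
          ((deriv (fun r : ℝ => deriv (fun s : ℝ => (avgTow (QBlev L (cubic d (evenPeriod t))) ((L : ℝ) ^ d)
          (fun k' => (calDalev L (cubic d (evenPeriod t)) a ha k' + covPert L (cubic d (evenPeriod t)) (fun k'' ν' (x' : idx L (cubic d (evenPeriod t)) k'') => Complex.exp
                ((Complex.I * ((A t k'' ν' x' : ℝ) : ℂ) / ((lev L k'' : ℕ) : ℂ)) * ((s : ℝ) : ℂ) + (Complex.I * ((B t k'' ν' x' : ℝ) : ℂ) / ((lev L k'' : ℕ) : ℂ)) * ((r : ℝ) :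
                ℂ))) k')⁻¹) k)⁻¹) 0) 0)
            ((unitIdx L (cubic d (evenPeriod t))).symm (z, μ')) ((unitIdx L (cubic d (evenPeriod t))).symm (0, ν'))).re) (P k))
    (hc : ∀ k, IsInfiniteVolumeLimit evenPeriod
      (fun t μ' ν' (z : Site d (evenPeriod t)) =>
          ((deriv (fun r : ℝ => deriv (fun s : ℝ => (avgTow (QBlev L (cubic d (evenPeriod t))) ((L : ℝ) ^ d)
          (fun k' => (calDalev L (cubic d (evenPeriod t)) a ha k' + covPert L (cubic d (evenPeriod t)) (fun k'' ν' (x' : idx L (cubic d (evenPeriod t)) k'') => Complex.exp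
                ((Complex.I * ((c * A t k'' ν' x' : ℝ) : ℂ) / ((lev L k'' : ℕ) : ℂ)) * ((s : ℝ) : ℂ) + (Complex.I * ((B t k'' ν' x' : ℝ) : ℂ) / ((lev L k'' : ℕ) : ℂ)) * ((r : ℝ) :
                ℂ))) k')⁻¹) k)⁻¹) 0) 0)
            ((unitIdx L (cubic d (evenPeriod t))).symm (z, μ')) ((unitIdx L (cubic d (evenPeriod t))).symm (0, ν'))).re) (Pc k)) :
    (∀ k μ ν, B12Beta.secondMoment (Pc k) μ ν = c * B12Beta.secondMoment (P k) μ ν) ∧ (∀ μ ν x, limKernelOf Pc μ ν x = c * limKernelOf P μ ν x) ∧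
      ∀ μ ν, B12Beta.secondMoment (limKernelOf Pc) μ ν = c * B12Beta.secondMoment (limKernelOf P) μ ν := by
  have e : ∀ k μ ν x, Pc k μ ν x = c * P k μ ν x := fun k => hessianKernel_smul_left L a ha c k (h k) (hc k)
  exact ⟨fun k μ ν => secondMoment_const_mul c (e k μ ν), fun μ ν x => limKernelOf_const_mul_apply c fun k => e k μ ν x,
    fun μ ν => secondMoment_limKernelOf_const_mul c fun k => e k μ ν⟩

/-- `hessianMoments_smul_right` — homogeneity in the second background (PART 258's `hessianKernel_smul_right`), NO analytic hypothesis. [our proof] -/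
theorem hessianMoments_smul_right (c : ℝ) {A B : (t : ℕ) → (k : ℕ) → Fin d → (idx L (cubic d (evenPeriod t)) k → ℝ)} {P Pc : ℕ → B12Beta.Kernel d}
    (h : ∀ k, IsInfiniteVolumeLimit evenPeriod
      (fun t μ' ν' (z : Site d (evenPeriod t)) =>
          ((deriv (fun r : ℝ => deriv (fun s : ℝ => (avgTow (QBlev L (cubic d (evenPeriod t))) ((L : ℝ) ^ d)
          (fun k' => (calDalev L (cubic d (evenPeriod t)) a ha k' + covPert L (cubic d (evenPeriod t)) (fun k'' ν' (x' : idx L (cubic d (evenPeriod t)) k'') => Complex.exp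
                ((Complex.I * ((A t k'' ν' x' : ℝ) : ℂ) / ((lev L k'' : ℕ) : ℂ)) * ((s : ℝ) : ℂ) + (Complex.I * ((B t k'' ν' x' : ℝ) : ℂ) / ((lev L k'' : ℕ) : ℂ)) * ((r : ℝ) :
                ℂ))) k')⁻¹) k)⁻¹) 0) 0)
            ((unitIdx L (cubic d (evenPeriod t))).symm (z, μ')) ((unitIdx L (cubic d (evenPeriod t))).symm (0, ν'))).re) (P k))
    (hc : ∀ k, IsInfiniteVolumeLimit evenPeriod
      (fun t μ' ν' (z : Site d (evenPeriod t)) =>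
          ((deriv (fun r : ℝ => deriv (fun s : ℝ => (avgTow (QBlev L (cubic d (evenPeriod t))) ((L : ℝ) ^ d)
          (fun k' => (calDalev L (cubic d (evenPeriod t)) a ha k' + covPert L (cubic d (evenPeriod t)) (fun k'' ν' (x' : idx L (cubic d (evenPeriod t)) k'') => Complex.exp
                ((Complex.I * ((A t k'' ν' x' : ℝ) : ℂ) / ((lev L k'' : ℕ) : ℂ)) * ((s : ℝ) : ℂ) + (Complex.I * ((c * B t k'' ν' x' : ℝ) : ℂ) / ((lev L k'' : ℕ) : ℂ)) * ((r : ℝ) :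
                ℂ))) k')⁻¹) k)⁻¹) 0) 0)
            ((unitIdx L (cubic d (evenPeriod t))).symm (z, μ')) ((unitIdx L (cubic d (evenPeriod t))).symm (0, ν'))).re) (Pc k)) :
    (∀ k μ ν, B12Beta.secondMoment (Pc k) μ ν = c * B12Beta.secondMoment (P k) μ ν) ∧ (∀ μ ν x, limKernelOf Pc μ ν x = c * limKernelOf P μ ν x) ∧
      ∀ μ ν, B12Beta.secondMoment (limKernelOf Pc) μ ν = c * B12Beta.secondMoment (limKernelOf P) μ ν := by
  have e : ∀ k μ ν x, Pc k μ ν x = c * P k μ ν x := fun k => hessianKernel_smul_right L a ha c k (h k) (hc k)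
  exact ⟨fun k μ ν => secondMoment_const_mul c (e k μ ν), fun μ ν x => limKernelOf_const_mul_apply c fun k => e k μ ν x,
    fun μ ν => secondMoment_limKernelOf_const_mul c fun k => e k μ ν⟩

/-- **`hessianMoments_add_left` — ADDITIVITY IN THE FIRST BACKGROUND**: for ANY limit kernels `Π₁, Π₂, Π₁₂` of the Hessian families of `(A₁, B)`, `(A₂, B)`, `(A₁ + A₂, B)`
(every level) and a pair `(μ, ν)`: (i) under (UD) `UniformDecay` with `δ > 0` for `Π₁, Π₂` (absolute convergence of (1.22)), `b_k(A₁ + A₂, B) = b_k(A₁, B) + b_k(A₂, B)` at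
every level; (ii) if moreover the three families have the END's rate `|b_k − b_∞| ≤ c·θ^k` (`0 ≤ θ < 1`), `b_∞(A₁ + A₂, B) = b_∞(A₁, B) + b_∞(A₂, B)` (PART 258's
`hessianKernel_add_left`; §1).  PART 254's END supplies every hypothesis (§3). [our proof] -/
theorem hessianMoments_add_left {A₁ A₂ B : (t : ℕ) → (k : ℕ) → Fin d → (idx L (cubic d (evenPeriod t)) k → ℝ)} {P₁ P₂ P₁₂ : ℕ → B12Beta.Kernel d}
    (h₁ : ∀ k, IsInfiniteVolumeLimit evenPeriod
      (fun t μ' ν' (z : Site d (evenPeriod t)) =>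
          ((deriv (fun r : ℝ => deriv (fun s : ℝ => (avgTow (QBlev L (cubic d (evenPeriod t))) ((L : ℝ) ^ d)
          (fun k' => (calDalev L (cubic d (evenPeriod t)) a ha k' + covPert L (cubic d (evenPeriod t)) (fun k'' ν' (x' : idx L (cubic d (evenPeriod t)) k'') => Complex.exp
                ((Complex.I * ((A₁ t k'' ν' x' : ℝ) : ℂ) / ((lev L k'' : ℕ) : ℂ)) * ((s : ℝ) : ℂ) + (Complex.I * ((B t k'' ν' x' : ℝ) : ℂ) / ((lev L k'' : ℕ) : ℂ)) * ((r : ℝ) :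
                ℂ))) k')⁻¹) k)⁻¹) 0) 0)
            ((unitIdx L (cubic d (evenPeriod t))).symm (z, μ')) ((unitIdx L (cubic d (evenPeriod t))).symm (0, ν'))).re) (P₁ k))
    (h₂ : ∀ k, IsInfiniteVolumeLimit evenPeriod
      (fun t μ' ν' (z : Site d (evenPeriod t)) =>
          ((deriv (fun r : ℝ => deriv (fun s : ℝ => (avgTow (QBlev L (cubic d (evenPeriod t))) ((L : ℝ) ^ d)
          (fun k' => (calDalev L (cubic d (evenPeriod t)) a ha k' + covPert L (cubic d (evenPeriod t)) (fun k'' ν' (x' : idx L (cubic d (evenPeriod t)) k'') => Complex.exp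
                ((Complex.I * ((A₂ t k'' ν' x' : ℝ) : ℂ) / ((lev L k'' : ℕ) : ℂ)) * ((s : ℝ) : ℂ) + (Complex.I * ((B t k'' ν' x' : ℝ) : ℂ) / ((lev L k'' : ℕ) : ℂ)) * ((r : ℝ) :
                ℂ))) k')⁻¹) k)⁻¹) 0) 0)
            ((unitIdx L (cubic d (evenPeriod t))).symm (z, μ')) ((unitIdx L (cubic d (evenPeriod t))).symm (0, ν'))).re) (P₂ k))
    (h₁₂ : ∀ k, IsInfiniteVolumeLimit evenPeriod
      (fun t μ' ν' (z : Site d (evenPeriod t)) =>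
          ((deriv (fun r : ℝ => deriv (fun s : ℝ => (avgTow (QBlev L (cubic d (evenPeriod t))) ((L : ℝ) ^ d)
          (fun k' => (calDalev L (cubic d (evenPeriod t)) a ha k' + covPert L (cubic d (evenPeriod t)) (fun k'' ν' (x' : idx L (cubic d (evenPeriod t)) k'') => Complex.exp
                ((Complex.I * ((A₁ t k'' ν' x' + A₂ t k'' ν' x' : ℝ) : ℂ) / ((lev L k'' : ℕ) : ℂ)) * ((s : ℝ) : ℂ) + (Complex.I * ((B t k'' ν' x' : ℝ) : ℂ) / ((lev L k'' : ℕ) : ℂ)) * ((r : ℝ) :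
                ℂ))) k')⁻¹) k)⁻¹) 0) 0)
            ((unitIdx L (cubic d (evenPeriod t))).symm (z, μ')) ((unitIdx L (cubic d (evenPeriod t))).symm (0, ν'))).re) (P₁₂ k))
    {μ ν : Fin d} {C₁ δ₁ C₂ δ₂ : ℝ} (hU₁ : UniformDecay P₁ μ ν C₁ δ₁) (hδ₁ : 0 < δ₁) (hU₂ : UniformDecay P₂ μ ν C₂ δ₂) (hδ₂ : 0 < δ₂) :
    (∀ k, B12Beta.secondMoment (P₁₂ k) μ ν = B12Beta.secondMoment (P₁ k) μ ν + B12Beta.secondMoment (P₂ k) μ ν) ∧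
      ∀ {c₁ c₂ c₁₂ θ : ℝ}, 0 ≤ θ → θ < 1 →
        (∀ k, |B12Beta.secondMoment (P₁ k) μ ν - B12Beta.secondMoment (limKernelOf P₁) μ ν| ≤ c₁ * θ ^ k) →
        (∀ k, |B12Beta.secondMoment (P₂ k) μ ν - B12Beta.secondMoment (limKernelOf P₂) μ ν| ≤ c₂ * θ ^ k) →
        (∀ k, |B12Beta.secondMoment (P₁₂ k) μ ν - B12Beta.secondMoment (limKernelOf P₁₂) μ ν| ≤ c₁₂ * θ ^ k) →
          B12Beta.secondMoment (limKernelOf P₁₂) μ ν = B12Beta.secondMoment (limKernelOf P₁) μ ν + B12Beta.secondMoment (limKernelOf P₂) μ ν := by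
  have e : ∀ k μ ν x, P₁₂ k μ ν x = P₁ k μ ν x + P₂ k μ ν x := fun k => hessianKernel_add_left L a ha k (h₁ k) (h₂ k) (h₁₂ k)
  have hlev : ∀ k, B12Beta.secondMoment (P₁₂ k) μ ν = B12Beta.secondMoment (P₁ k) μ ν + B12Beta.secondMoment (P₂ k) μ ν := fun k =>
    secondMoment_add_of_summable (e k μ ν) (hU₁.summable hδ₁ k) (hU₂.summable hδ₂ k)
  exact ⟨hlev, fun hθ0 hθ1 hr₁ hr₂ hr₁₂ => secondMoment_limKernelOf_add_of_rate hθ0 hθ1 hr₁ hr₂ hr₁₂ hlev⟩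

/-- `limKernelOf_hessianKernel_add_left` — the telescoped limit KERNELS add in the `(μ, ν)` component under (PR′) `StepRate` for the two summands (`0 ≤ θ < 1`).
[our proof] -/
theorem limKernelOf_hessianKernel_add_left {A₁ A₂ B : (t : ℕ) → (k : ℕ) → Fin d → (idx L (cubic d (evenPeriod t)) k → ℝ)} {P₁ P₂ P₁₂ : ℕ → B12Beta.Kernel d}
    (h₁ : ∀ k, IsInfiniteVolumeLimit evenPeriod
      (fun t μ' ν' (z : Site d (evenPeriod t)) =>
          ((deriv (fun r : ℝ => deriv (fun s : ℝ => (avgTow (QBlev L (cubic d (evenPeriod t))) ((L : ℝ) ^ d)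
          (fun k' => (calDalev L (cubic d (evenPeriod t)) a ha k' + covPert L (cubic d (evenPeriod t)) (fun k'' ν' (x' : idx L (cubic d (evenPeriod t)) k'') => Complex.exp
                ((Complex.I * ((A₁ t k'' ν' x' : ℝ) : ℂ) / ((lev L k'' : ℕ) : ℂ)) * ((s : ℝ) : ℂ) + (Complex.I * ((B t k'' ν' x' : ℝ) : ℂ) / ((lev L k'' : ℕ) : ℂ)) * ((r : ℝ) :
                ℂ))) k')⁻¹) k)⁻¹) 0) 0)
            ((unitIdx L (cubic d (evenPeriod t))).symm (z, μ')) ((unitIdx L (cubic d (evenPeriod t))).symm (0, ν'))).re) (P₁ k))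
    (h₂ : ∀ k, IsInfiniteVolumeLimit evenPeriod
      (fun t μ' ν' (z : Site d (evenPeriod t)) =>
          ((deriv (fun r : ℝ => deriv (fun s : ℝ => (avgTow (QBlev L (cubic d (evenPeriod t))) ((L : ℝ) ^ d)
          (fun k' => (calDalev L (cubic d (evenPeriod t)) a ha k' + covPert L (cubic d (evenPeriod t)) (fun k'' ν' (x' : idx L (cubic d (evenPeriod t)) k'') => Complex.exp
                ((Complex.I * ((A₂ t k'' ν' x' : ℝ) : ℂ) / ((lev L k'' : ℕ) : ℂ)) * ((s : ℝ) : ℂ) + (Complex.I * ((B t k'' ν' x' : ℝ) : ℂ) / ((lev L k'' : ℕ) : ℂ)) * ((r : ℝ) :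
                ℂ))) k')⁻¹) k)⁻¹) 0) 0)
            ((unitIdx L (cubic d (evenPeriod t))).symm (z, μ')) ((unitIdx L (cubic d (evenPeriod t))).symm (0, ν'))).re) (P₂ k))
    (h₁₂ : ∀ k, IsInfiniteVolumeLimit evenPeriod
      (fun t μ' ν' (z : Site d (evenPeriod t)) =>
          ((deriv (fun r : ℝ => deriv (fun s : ℝ => (avgTow (QBlev L (cubic d (evenPeriod t))) ((L : ℝ) ^ d)
          (fun k' => (calDalev L (cubic d (evenPeriod t)) a ha k' + covPert L (cubic d (evenPeriod t)) (fun k'' ν' (x' : idx L (cubic d (evenPeriod t)) k'') => Complex.exp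
                ((Complex.I * ((A₁ t k'' ν' x' + A₂ t k'' ν' x' : ℝ) : ℂ) / ((lev L k'' : ℕ) : ℂ)) * ((s : ℝ) : ℂ) + (Complex.I * ((B t k'' ν' x' : ℝ) : ℂ) / ((lev L k'' : ℕ) : ℂ)) * ((r : ℝ) :
                ℂ))) k')⁻¹) k)⁻¹) 0) 0)
            ((unitIdx L (cubic d (evenPeriod t))).symm (z, μ')) ((unitIdx L (cubic d (evenPeriod t))).symm (0, ν'))).re) (P₁₂ k))
    {μ ν : Fin d} {C₁ δ₁ C₂ δ₂ θ : ℝ} (hθ0 : 0 ≤ θ) (hθ1 : θ < 1) (hS₁ : StepRate P₁ μ ν C₁ δ₁ θ) (hS₂ : StepRate P₂ μ ν C₂ δ₂ θ) (x : Fin d → ℤ) :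
    limKernelOf P₁₂ μ ν x = limKernelOf P₁ μ ν x + limKernelOf P₂ μ ν x :=
  limKernelOf_add_apply_of_stepRate hθ0 hθ1 hS₁ hS₂ (fun k x => hessianKernel_add_left L a ha k (h₁ k) (h₂ k) (h₁₂ k) μ ν x) x

/-- `hessianMoments_add_right` — additivity in the second background, level numbers under (UD) and limit numbers under the END's rates (PART 258's
`hessianKernel_add_right`; §1). [our proof] -/
theorem hessianMoments_add_right {A B₁ B₂ : (t : ℕ) → (k : ℕ) → Fin d → (idx L (cubic d (evenPeriod t)) k → ℝ)} {P₁ P₂ P₁₂ : ℕ → B12Beta.Kernel d}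
    (h₁ : ∀ k, IsInfiniteVolumeLimit evenPeriod
      (fun t μ' ν' (z : Site d (evenPeriod t)) =>
          ((deriv (fun r : ℝ => deriv (fun s : ℝ => (avgTow (QBlev L (cubic d (evenPeriod t))) ((L : ℝ) ^ d)
          (fun k' => (calDalev L (cubic d (evenPeriod t)) a ha k' + covPert L (cubic d (evenPeriod t)) (fun k'' ν' (x' : idx L (cubic d (evenPeriod t)) k'') => Complex.exp
                ((Complex.I * ((A t k'' ν' x' : ℝ) : ℂ) / ((lev L k'' : ℕ) : ℂ)) * ((s : ℝ) : ℂ) + (Complex.I * ((B₁ t k'' ν' x' : ℝ) : ℂ) / ((lev L k'' : ℕ) : ℂ)) * ((r : ℝ) :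
                ℂ))) k')⁻¹) k)⁻¹) 0) 0)
            ((unitIdx L (cubic d (evenPeriod t))).symm (z, μ')) ((unitIdx L (cubic d (evenPeriod t))).symm (0, ν'))).re) (P₁ k))
    (h₂ : ∀ k, IsInfiniteVolumeLimit evenPeriod
      (fun t μ' ν' (z : Site d (evenPeriod t)) =>
          ((deriv (fun r : ℝ => deriv (fun s : ℝ => (avgTow (QBlev L (cubic d (evenPeriod t))) ((L : ℝ) ^ d)
          (fun k' => (calDalev L (cubic d (evenPeriod t)) a ha k' + covPert L (cubic d (evenPeriod t)) (fun k'' ν' (x' : idx L (cubic d (evenPeriod t)) k'') => Complex.exp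
                ((Complex.I * ((A t k'' ν' x' : ℝ) : ℂ) / ((lev L k'' : ℕ) : ℂ)) * ((s : ℝ) : ℂ) + (Complex.I * ((B₂ t k'' ν' x' : ℝ) : ℂ) / ((lev L k'' : ℕ) : ℂ)) * ((r : ℝ) :
                ℂ))) k')⁻¹) k)⁻¹) 0) 0)
            ((unitIdx L (cubic d (evenPeriod t))).symm (z, μ')) ((unitIdx L (cubic d (evenPeriod t))).symm (0, ν'))).re) (P₂ k))
    (h₁₂ : ∀ k, IsInfiniteVolumeLimit evenPeriod
      (fun t μ' ν' (z : Site d (evenPeriod t)) =>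
          ((deriv (fun r : ℝ => deriv (fun s : ℝ => (avgTow (QBlev L (cubic d (evenPeriod t))) ((L : ℝ) ^ d)
          (fun k' => (calDalev L (cubic d (evenPeriod t)) a ha k' + covPert L (cubic d (evenPeriod t)) (fun k'' ν' (x' : idx L (cubic d (evenPeriod t)) k'') => Complex.exp
                ((Complex.I * ((A t k'' ν' x' : ℝ) : ℂ) / ((lev L k'' : ℕ) : ℂ)) * ((s : ℝ) : ℂ) + (Complex.I * ((B₁ t k'' ν' x' + B₂ t k'' ν' x' : ℝ) : ℂ) / ((lev L k'' : ℕ) : ℂ)) * ((r : ℝ) :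
                ℂ))) k')⁻¹) k)⁻¹) 0) 0)
            ((unitIdx L (cubic d (evenPeriod t))).symm (z, μ')) ((unitIdx L (cubic d (evenPeriod t))).symm (0, ν'))).re) (P₁₂ k))
    {μ ν : Fin d} {C₁ δ₁ C₂ δ₂ : ℝ} (hU₁ : UniformDecay P₁ μ ν C₁ δ₁) (hδ₁ : 0 < δ₁) (hU₂ : UniformDecay P₂ μ ν C₂ δ₂) (hδ₂ : 0 < δ₂) :
    (∀ k, B12Beta.secondMoment (P₁₂ k) μ ν = B12Beta.secondMoment (P₁ k) μ ν + B12Beta.secondMoment (P₂ k) μ ν) ∧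
      ∀ {c₁ c₂ c₁₂ θ : ℝ}, 0 ≤ θ → θ < 1 →
        (∀ k, |B12Beta.secondMoment (P₁ k) μ ν - B12Beta.secondMoment (limKernelOf P₁) μ ν| ≤ c₁ * θ ^ k) →
        (∀ k, |B12Beta.secondMoment (P₂ k) μ ν - B12Beta.secondMoment (limKernelOf P₂) μ ν| ≤ c₂ * θ ^ k) →
        (∀ k, |B12Beta.secondMoment (P₁₂ k) μ ν - B12Beta.secondMoment (limKernelOf P₁₂) μ ν| ≤ c₁₂ * θ ^ k) →
          B12Beta.secondMoment (limKernelOf P₁₂) μ ν = B12Beta.secondMoment (limKernelOf P₁) μ ν + B12Beta.secondMoment (limKernelOf P₂) μ ν := by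
  have e : ∀ k μ ν x, P₁₂ k μ ν x = P₁ k μ ν x + P₂ k μ ν x := fun k => hessianKernel_add_right L a ha k (h₁ k) (h₂ k) (h₁₂ k)
  have hlev : ∀ k, B12Beta.secondMoment (P₁₂ k) μ ν = B12Beta.secondMoment (P₁ k) μ ν + B12Beta.secondMoment (P₂ k) μ ν := fun k =>
    secondMoment_add_of_summable (e k μ ν) (hU₁.summable hδ₁ k) (hU₂.summable hδ₂ k)
  exact ⟨hlev, fun hθ0 hθ1 hr₁ hr₂ hr₁₂ => secondMoment_limKernelOf_add_of_rate hθ0 hθ1 hr₁ hr₂ hr₁₂ hlev⟩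

end Hessian


end Summit.QuantumFields.BalabanUV.Beta.GAN24.ExponentialChartHessianMoments

end
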